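import Summits.HubbardSuperconductivity.HubbardSuperconductivity.Theorems.BirComplexStableXY.Negative.BirComplexStableXYFalseOfStiffModulusCrossing
import Summits.HubbardSuperconductivity.HubbardSuperconductivity.Theorems.BalabanIRBirGappedPhaseReductionVacuousStiff

/-!
# Route BalabanIR — support item `BirGappedPhaseReduction` (stmt-HubbardSuperconductivity-2082) closed MODULO `StiffModulusCrossing`

Bookkeeping update of `Theorems/BalabanIRBirGappedPhaseReductionVacuousStiff.lean` for the WEAKEST hypothesis of the
engine's negative lane so far (prover seat c3-0, 2026-08-16).  The rev-0 reduction record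
`BirGappedPhaseReduction := BirComplexStableXY → BirGroundStateAverageLRO` is glue (`¬ item ↔ engine ∧ ¬ target`,
`Theorems.not_birGappedPhaseReduction_iff`); the negative lane of crux stmt-HubbardSuperconductivity-2080 is now closed
modulo `StiffModulusCrossing` (`Theorems/BirComplexStableXY/Negative/BirComplexStableXYFalseOfStiffModulusCrossing.lean`:
single-dominant asymptotics at two stiffness points + zero-free continuation of one sector eigenvalue; implied by
`StiffTwoLevelStructure`).  Composing with ex falso: the construction item for ANY of the three hearts
(`WitnessZeroExists`, `StiffTwoLevelStructure`, `StiffModulusCrossing`) settles stmt-2080 (refuted) and stmt-2082 (proved,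
vacuously) at once.  This file imports `Theses.BalabanIR` transitively and is NOT a closing module (materialisation rule of
the route); it is a `--supports stmt-HubbardSuperconductivity-2082` record.  No definition is introduced.
-/

set_option linter.dupNamespace false

namespace Summit.HubbardSuperconductivity.HubbardSuperconductivity.Theorems

open Summit.HubbardSuperconductivity.HubbardSuperconductivity.Theses.BalabanIR
open Summit.HubbardSuperconductivity.BirComplexStableXYNegative

/-- `BirGappedPhaseReduction` (stmt-HubbardSuperconductivity-2082) holds modulo `StiffModulusCrossing`:
modulus crossing refutes the antecedent `BirComplexStableXY`, so the implication holds vacuously.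
(Composition of `BirComplexStableXY_false_of_StiffModulusCrossing` with ex falso.) [folklore] -/
theorem birGappedPhaseReduction_of_stiffModulusCrossing (hS : StiffModulusCrossing) :
    BirGappedPhaseReduction :=
  fun hE => absurd hE (BirComplexStableXY_false_of_StiffModulusCrossing hS)

/-- Any of the three analytic hearts of the engine's negative lane closes stmt-2082. [folklore] -/
theorem birGappedPhaseReduction_of_hearts
    (h : WitnessZeroExists ∨ StiffTwoLevelStructure ∨ StiffModulusCrossing) : BirGappedPhaseReduction :=
  h.elim birGappedPhaseReduction_of_witnessZeroExists fun h' =>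
    h'.elim birGappedPhaseReduction_of_stiffTwoLevelStructure birGappedPhaseReduction_of_stiffModulusCrossing

end Summit.HubbardSuperconductivity.HubbardSuperconductivity.Theorems
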